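import Literature.InformationTheory.Entropy.WeakMonotonicityFromRelEntropy
import HarnessLib

/-!
# Concavity of the quantum conditional entropy (Lieb–Ruskai 1973, Theorem 1)

For a bipartite density matrix `ρ_{AB}` the conditional entropy `S(A|B)_ρ = S(ρ_{AB}) − S(ρ_B)`
(`ρ_B = Tr_A ρ_{AB}`) is a CONCAVE function of `ρ_{AB}` [cite: LiebRuskai1973, Theorem 1]
("the function `F(ρ₁₂) = S(ρ₁) − S(ρ₁₂)` is convex on the set of positive trace-class operators")
[cite: NielsenChuang2010, Corollary 11.13 p.521]. Lieb–Ruskai note (§III (A)) that it FOLLOWS from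
strong subadditivity (their Theorem 2) applied to the block-diagonal tripartite operator
`ρ₁₂₃ = α ρ₁₂ ⊗ E + β σ₁₂ ⊗ F` with `E, F` orthogonal one-dimensional projections on `ℋ₃`; this is
Nielsen–Chuang's auxiliary classical register `ρ^{AB…X} = Σ_x p_x ρ_x ⊗ |x⟩⟨x|`
[cite: NielsenChuang2010, §11.3.5 eqs. (11.80)–(11.83) p.517; Exercise 11.25 p.522].

We follow exactly that road, on top of the in-tree strong subadditivity
`strongSubadditivity_of_relEntropy_partialTrace_le` (`WeakMonotonicityFromRelEntropy.lean`, itself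
from Lindblad's monotonicity `relEntropy_partialTrace_le_holds`):

* `vonNeumannEntropy_blockDiagonal`: `S(⊕_x τ_x) = Σ_x S(τ_x)` — the characteristic polynomial of a
  block-diagonal matrix is the product of those of its blocks and `S` is a sum over its roots
  (`vonNeumannEntropy_eq_sum_roots_charpoly`); this is (11.83) without normalising the blocks;
* `sum_vonNeumannEntropy_sub_traceLeft_le` (the homogeneous form of Lieb–Ruskai's Theorem 1): for
  positive semidefinite blocks `τ_x` on `ℋ_A ⊗ ℋ_B` with `Σ_x Tr τ_x = 1`,
  `Σ_x (S(τ_x) − S(Tr_A τ_x)) ≤ S(Σ_x τ_x) − S(Tr_A Σ_x τ_x)`, by SSA for the classical–quantum state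
  `⊕_x τ_x` on `ℋ_A ⊗ ℋ_B ⊗ ℂ^X` whose four marginals are `⊕_x τ_x`, `Σ_x τ_x`, `⊕_x Tr_A τ_x`,
  `Tr_A Σ_x τ_x`; and its twin `sum_vonNeumannEntropy_sub_traceRight_le` (trace out `B`);
* `vonNeumannEntropy_smul`: `S(c ρ) = c S(ρ) + η(c) Tr ρ` (`η(c) = −c log c`, `c ≥ 0`), whence the
  textbook weighted form `Σ_x p_x (S(ρ_x) − S(Tr ρ_x)) ≤ S(ρ̄) − S(Tr ρ̄)`, `ρ̄ = Σ_x p_x ρ_x`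
  (`convexComb_vonNeumannEntropy_sub_traceLeft_le` / `…traceRight_le`), and the form used by
  symmetrised SDP relaxations: if every `ρ_x` has a nonnegative conditional entropy then so has their
  average (`vonNeumannEntropy_sub_traceLeft_avg_nonneg` / `…traceRight…`);
* `vonNeumannEntropy_unitary_conj`: `S(U ρ U⋆) = S(ρ)`.

Application (lever family `ent` of `Summits/Ventures/CertifiedManyBodySolver`): the entropy
antecedent `0 ≤ S(ρ_{[1,k]}) − S(ρ_{[1,k−1]})` of a translation-invariant window state survives the
averaging of the window state over a finite symmetry group acting by unitary conjugation
[cite: FawziFawziScalet2024Entropy, Theorem 4.1]. All index types of the bipartite statements live in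
`Type` because the strong-subadditivity theorem they rest on quantifies over `Type`.
-/

namespace Literature.InformationTheory.Entropy

open Matrix
open scoped BigOperators ComplexOrder

open Literature.Computability.QuantumComplexity (traceLeft traceRight IsDensity traceLeft_apply
  traceRight_apply trace_traceLeft trace_traceRight)

/-! ### Block-diagonal (classical–quantum) matrices -/

section BlockDiagonal

variable {m : Type*} [Fintype m] [DecidableEq m] {X : Type*} [Fintype X] [DecidableEq X]

/-- The characteristic polynomial of a block-diagonal matrix is the product of the characteristic
polynomials of its blocks (its `charmatrix` is block diagonal; `Matrix.det_blockDiagonal`). The same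
statement over a general commutative ring is `charpoly_blockDiagonal` in
`Literature/NumberTheory/Automorphic/AshSmithTheoryHeckeCharpolyProofs.lean`; restated here over `ℂ`
to keep the entropy files free of that import. [folklore] -/
private theorem charpoly_blockDiagonal_complex (M : X → Matrix m m ℂ) :
    (blockDiagonal M).charpoly = ∏ k, (M k).charpoly := by
  have h : (blockDiagonal M).charmatrix = blockDiagonal fun k => (M k).charmatrix := by
    ext ⟨i, k⟩ ⟨j, k'⟩
    simp only [Matrix.charmatrix_apply, Matrix.blockDiagonal_apply, Matrix.diagonal_apply,
      Prod.mk.injEq]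
    by_cases hk : k = k'
    · subst hk
      simp
    · simp [hk]
  rw [Matrix.charpoly, h, Matrix.det_blockDiagonal]
  rfl

omit [Fintype m] [DecidableEq m] [Fintype X] in
/-- A block-diagonal matrix with Hermitian blocks is Hermitian (the classical–quantum operator
`Σ_i p_i ρ_i ⊗ |i⟩⟨i|` is self-adjoint). [cite: NielsenChuang2010, §11.3.5 eq. (11.80) p.517] -/
theorem isHermitian_blockDiagonal {M : X → Matrix m m ℂ} (hM : ∀ k, (M k).IsHermitian) :
    (blockDiagonal M).IsHermitian := by
  unfold Matrix.IsHermitian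
  rw [Matrix.blockDiagonal_conjTranspose]
  congr 1
  funext k
  exact hM k

open scoped MatrixOrder in
/-- A block-diagonal matrix with positive semidefinite blocks is positive semidefinite (each block is
a Gram matrix `C_k⋆ C_k`, so the whole is `(⊕ C_k)⋆ (⊕ C_k)`): the classical–quantum operator
`Σ_i p_i ρ_i ⊗ |i⟩⟨i|` is a (sub-normalised) density operator.
[cite: NielsenChuang2010, §11.3.5 eq. (11.80) p.517] -/
theorem posSemidef_blockDiagonal {M : X → Matrix m m ℂ} (hM : ∀ k, (M k).PosSemidef) :
    (blockDiagonal M).PosSemidef := by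
  have hC : ∀ k, ∃ C : Matrix m m ℂ, M k = Cᴴ * C := fun k => by
    obtain ⟨C, hC⟩ := CStarAlgebra.nonneg_iff_eq_star_mul_self.mp (hM k).nonneg
    exact ⟨C, by rw [hC, Matrix.star_eq_conjTranspose]⟩
  choose C hC using hC
  have e : blockDiagonal M = (blockDiagonal C)ᴴ * blockDiagonal C := by
    rw [Matrix.blockDiagonal_conjTranspose, ← Matrix.blockDiagonal_mul]
    congr 1
    funext k
    exact hC k
  rw [e]
  exact Matrix.posSemidef_conjTranspose_mul_self _

/-- **Entropy of a classical–quantum (block-diagonal) operator**: `S(⊕_x τ_x) = Σ_x S(τ_x)` for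
Hermitian blocks — the spectrum of `⊕_x τ_x` is the union of the spectra of the blocks. With
`τ_x = p_x ρ_x` this is Nielsen–Chuang's `S(A,B) = H(p) + Σ_x p_x S(ρ_x)`.
[cite: NielsenChuang2010, §11.3.5 eq. (11.83) p.517] -/
theorem vonNeumannEntropy_blockDiagonal {τ : X → Matrix m m ℂ} (hτ : ∀ x, (τ x).IsHermitian) :
    vonNeumannEntropy (blockDiagonal τ) = ∑ x, vonNeumannEntropy (τ x) := by
  rw [vonNeumannEntropy_eq_sum_roots_charpoly (isHermitian_blockDiagonal hτ),
    charpoly_blockDiagonal_complex, Polynomial.roots_prod _ _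
      (Finset.prod_ne_zero_iff.mpr fun k _ => (Matrix.charpoly_monic (τ k)).ne_zero),
    Multiset.map_bind, Multiset.sum_bind, ← Finset.sum_eq_multiset_sum]
  exact Finset.sum_congr rfl fun x _ => (vonNeumannEntropy_eq_sum_roots_charpoly (hτ x)).symm

omit [DecidableEq m] in
/-- The trace is invariant under relabelling by a bijection. [folklore] -/
private theorem trace_submatrix_equiv' {p : Type*} [Fintype p] (M : Matrix m m ℂ) (e : p ≃ m) :
    (M.submatrix e e).trace = M.trace := by
  simp only [Matrix.trace, Matrix.diag, Matrix.submatrix_apply]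
  exact e.sum_comp (fun i => M i i)

end BlockDiagonal

/-! ### Concavity of `ρ ↦ S(ρ_{AB}) − S(ρ_B)` (trace out the first factor) -/

section TraceLeft

variable {A B X : Type} [Fintype A] [DecidableEq A] [Fintype B] [DecidableEq B] [Fintype X]
  [DecidableEq X]

omit [DecidableEq X] in
/-- Entries of a finite sum of matrices. [folklore] -/
private theorem fintype_sum_apply {p : Type*} (τ : X → Matrix p p ℂ) (i j : p) :
    (∑ x, τ x) i j = ∑ x, τ x i j := Matrix.sum_apply i j Finset.univ τ

omit [DecidableEq X] in
/-- A finite sum of Hermitian matrices is Hermitian. [folklore] -/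
private theorem isHermitian_sum' {p : Type*} {τ : X → Matrix p p ℂ} (hτ : ∀ x, (τ x).IsHermitian) :
    (∑ x, τ x).IsHermitian := by
  unfold Matrix.IsHermitian
  rw [Matrix.conjTranspose_sum]
  exact Finset.sum_congr rfl fun x _ => hτ x

omit [Fintype B] [DecidableEq B] [DecidableEq A] [DecidableEq X] in
/-- `Tr_A` is additive over finite sums (the partial trace is linear).
[cite: NielsenChuang2010, §2.4.3 eq. (2.178)] -/
theorem traceLeft_sum (τ : X → Matrix (A × B) (A × B) ℂ) :
    traceLeft (∑ x, τ x) = ∑ x, traceLeft (τ x) := by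
  ext b b'
  rw [traceLeft_apply, fintype_sum_apply]
  simp only [fintype_sum_apply, traceLeft_apply]
  exact Finset.sum_comm

omit [Fintype A] [DecidableEq A] [DecidableEq B] [DecidableEq X] in
/-- `Tr_B` is additive over finite sums (the partial trace is linear).
[cite: NielsenChuang2010, §2.4.3 eq. (2.178)] -/
theorem traceRight_sum (τ : X → Matrix (A × B) (A × B) ℂ) :
    traceRight (∑ x, τ x) = ∑ x, traceRight (τ x) := by
  ext a a'
  rw [traceRight_apply, fintype_sum_apply]
  simp only [fintype_sum_apply, traceRight_apply]
  exact Finset.sum_comm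

omit [Fintype B] [DecidableEq B] [DecidableEq A] in
/-- `Tr_A (c ρ) = c Tr_A ρ` (the partial trace is linear). [cite: NielsenChuang2010, §2.4.3 eq. (2.178)] -/
theorem traceLeft_smul (c : ℂ) (ρ : Matrix (A × B) (A × B) ℂ) :
    traceLeft (c • ρ) = c • traceLeft ρ := by
  ext b b'
  simp [traceLeft_apply, Finset.mul_sum]

omit [Fintype A] [DecidableEq A] [DecidableEq B] in
/-- `Tr_B (c ρ) = c Tr_B ρ` (the partial trace is linear). [cite: NielsenChuang2010, §2.4.3 eq. (2.178)] -/
theorem traceRight_smul (c : ℂ) (ρ : Matrix (A × B) (A × B) ℂ) :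
    traceRight (c • ρ) = c • traceRight ρ := by
  ext a a'
  simp [traceRight_apply, Finset.mul_sum]

omit [Fintype A] [DecidableEq A] [Fintype B] [DecidableEq B] in
/-- (m1) The `AB`-marginal of the classical–quantum operator `⊕_x τ_x` on `ℋ_A ⊗ ℋ_B ⊗ ℂ^X` is
`Σ_x τ_x`. [cite: NielsenChuang2010, §11.3.5 eq. (11.81) p.517] -/
private theorem traceLast_cq (τ : X → Matrix (A × B) (A × B) ℂ) :
    traceLast ((blockDiagonal τ).submatrix (Equiv.prodAssoc A B X).symm (Equiv.prodAssoc A B X).symm)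
      = ∑ x, τ x := by
  ext ⟨a, b⟩ ⟨a', b'⟩
  rw [traceLast_apply, fintype_sum_apply]
  refine Finset.sum_congr rfl fun x _ => ?_
  simp [Matrix.blockDiagonal_apply_eq]

omit [DecidableEq A] [Fintype B] [DecidableEq B] [Fintype X] in
/-- (m2) The `BX`-marginal of `⊕_x τ_x` is the classical–quantum operator `⊕_x Tr_A τ_x`.
[cite: NielsenChuang2010, §11.3.5 eqs. (11.80)–(11.83) p.517] -/
private theorem traceLeft_cq (τ : X → Matrix (A × B) (A × B) ℂ) :
    traceLeft ((blockDiagonal τ).submatrix (Equiv.prodAssoc A B X).symm (Equiv.prodAssoc A B X).symm)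
      = blockDiagonal fun x => traceLeft (τ x) := by
  ext ⟨b, x⟩ ⟨b', x'⟩
  rw [traceLeft_apply, Matrix.blockDiagonal_apply]
  by_cases hx : x = x'
  · subst hx
    simp [Matrix.blockDiagonal_apply_eq, traceLeft_apply]
  · simp [Matrix.blockDiagonal_apply_ne _ _ _ hx, hx]

/-- **Concavity of the conditional entropy `S(A|B) = S(ρ_{AB}) − S(ρ_B)`, homogeneous form**
(Lieb–Ruskai's Theorem 1: `ρ_{AB} ↦ S(Tr_A ρ_{AB}) − S(ρ_{AB})` is convex and positively homogeneous
on positive operators): for positive semidefinite `τ_x` on `ℋ_A ⊗ ℋ_B` (`x ∈ X`, finite) with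
`Σ_x Tr τ_x = 1`, `Σ_x (S(τ_x) − S(Tr_A τ_x)) ≤ S(Σ_x τ_x) − S(Tr_A Σ_x τ_x)`. Proof: strong
subadditivity `S(ABX) + S(B) ≤ S(AB) + S(BX)` for the classical–quantum density operator `⊕_x τ_x`
on `ℋ_A ⊗ ℋ_B ⊗ ℂ^X`, whose marginals are `⊕_x τ_x`, `Σ_x τ_x`, `⊕_x Tr_A τ_x`, `Tr_A Σ_x τ_x`,
together with `S(⊕_x M_x) = Σ_x S(M_x)`. [cite: LiebRuskai1973, Theorem 1 and §III (A)]
[cite: NielsenChuang2010, Corollary 11.13 p.521; Exercise 11.25 p.522] -/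
theorem sum_vonNeumannEntropy_sub_traceLeft_le (τ : X → Matrix (A × B) (A × B) ℂ)
    (hτ : ∀ x, (τ x).PosSemidef) (htr : ∑ x, (τ x).trace = 1) :
    ∑ x, (vonNeumannEntropy (τ x) - vonNeumannEntropy (traceLeft (τ x))) ≤
      vonNeumannEntropy (∑ x, τ x) - vonNeumannEntropy (traceLeft (∑ x, τ x)) := by
  set e := (Equiv.prodAssoc A B X).symm with he
  set T : Matrix (A × B × X) (A × B × X) ℂ := (blockDiagonal τ).submatrix e e with hT
  have hTd : IsDensity T := by
    refine ⟨(posSemidef_blockDiagonal hτ).submatrix e, ?_⟩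
    rw [hT, trace_submatrix_equiv', Matrix.trace_blockDiagonal, htr]
  have hSSA := strongSubadditivity_of_relEntropy_partialTrace_le relEntropy_partialTrace_le_holds T hTd
  have h1 : vonNeumannEntropy T = ∑ x, vonNeumannEntropy (τ x) := by
    rw [hT, vonNeumannEntropy_submatrix_equiv (isHermitian_blockDiagonal fun x => (hτ x).1) e,
      vonNeumannEntropy_blockDiagonal fun x => (hτ x).1]
  have h2 : traceLast T = ∑ x, τ x := traceLast_cq τ
  have h3 : vonNeumannEntropy (traceLeft T) = ∑ x, vonNeumannEntropy (traceLeft (τ x)) := by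
    rw [hT, traceLeft_cq, vonNeumannEntropy_blockDiagonal fun x => isHermitian_traceLeft (hτ x).1]
  rw [h1, h2, h3] at hSSA
  rw [Finset.sum_sub_distrib]
  linarith

end TraceLeft

/-! ### The twin: trace out the second factor -/

section TraceRight

variable {A B X : Type} [Fintype A] [DecidableEq A] [Fintype B] [DecidableEq B] [Fintype X]
  [DecidableEq X]

/-- **Concavity of `S(B|A) = S(ρ_{AB}) − S(ρ_A)`, homogeneous form**: for positive semidefinite
`τ_x` on `ℋ_A ⊗ ℋ_B` with `Σ_x Tr τ_x = 1`,
`Σ_x (S(τ_x) − S(Tr_B τ_x)) ≤ S(Σ_x τ_x) − S(Tr_B Σ_x τ_x)` (the previous theorem after swapping the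
two factors, `traceLeft_submatrix_swap`). [cite: LiebRuskai1973, Theorem 1 and §III (A)]
[cite: NielsenChuang2010, Corollary 11.13 p.521] -/
theorem sum_vonNeumannEntropy_sub_traceRight_le (τ : X → Matrix (A × B) (A × B) ℂ)
    (hτ : ∀ x, (τ x).PosSemidef) (htr : ∑ x, (τ x).trace = 1) :
    ∑ x, (vonNeumannEntropy (τ x) - vonNeumannEntropy (traceRight (τ x))) ≤
      vonNeumannEntropy (∑ x, τ x) - vonNeumannEntropy (traceRight (∑ x, τ x)) := by
  let sw : B × A ≃ A × B := Equiv.prodComm B A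
  have hsw : ∀ (ρ : Matrix (A × B) (A × B) ℂ), ρ.submatrix sw sw = ρ.submatrix Prod.swap Prod.swap :=
    fun ρ => rfl
  set τ' : X → Matrix (B × A) (B × A) ℂ := fun x => (τ x).submatrix sw sw with hτ'
  have hτ'p : ∀ x, (τ' x).PosSemidef := fun x => (hτ x).submatrix sw
  have htr' : ∑ x, (τ' x).trace = 1 := by
    simp only [hτ', trace_submatrix_equiv']
    exact htr
  have hsum : ∑ x, τ' x = (∑ x, τ x).submatrix sw sw := by
    ext i j
    simp only [hτ', Matrix.submatrix_apply, Matrix.sum_apply i j Finset.univ,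
      Matrix.sum_apply (sw i) (sw j) Finset.univ]
  have key := sum_vonNeumannEntropy_sub_traceLeft_le τ' hτ'p htr'
  have hS : ∀ x, vonNeumannEntropy (τ' x) = vonNeumannEntropy (τ x) := fun x =>
    vonNeumannEntropy_submatrix_equiv (hτ x).1 sw
  have hL : ∀ x, traceLeft (τ' x) = traceRight (τ x) := fun x => by
    simp only [hτ', hsw]
    exact traceLeft_submatrix_swap (τ x)
  have hSsum : vonNeumannEntropy (∑ x, τ' x) = vonNeumannEntropy (∑ x, τ x) := by
    rw [hsum]
    exact vonNeumannEntropy_submatrix_equiv (isHermitian_sum' fun x => (hτ x).1) sw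
  have hLsum : traceLeft (∑ x, τ' x) = traceRight (∑ x, τ x) := by
    rw [hsum, hsw]; exact traceLeft_submatrix_swap _
  simp only [hS, hL, hSsum, hLsum] at key
  exact key

end TraceRight

/-! ### Scaling, weighted form, averages -/

section Weighted

variable {m : Type*} [Fintype m] [DecidableEq m]

/-- **Entropy of a scaled operator**: `S(c ρ) = c S(ρ) + η(c) Re Tr ρ` for Hermitian `ρ` and real `c`,
`η(c) = −c log c` (`η(cλ) = c η(λ) + λ η(c)` eigenvalue by eigenvalue — with Mathlib's conventions
`log |·|`, `0 log 0 = 0` this needs no sign condition; functional-calculus form `S(ρ) = Re Tr η(ρ)`).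
For `c = p_i ≥ 0` this is the step `S(Σ p_i ρ_i ⊗ |i⟩⟨i|) = H(p) + Σ p_i S(ρ_i)`.
[cite: NielsenChuang2010, §11.3.5 eq. (11.83) p.517] -/
theorem vonNeumannEntropy_smul {ρ : Matrix m m ℂ} (hρ : ρ.IsHermitian) (c : ℝ) :
    vonNeumannEntropy ((c : ℂ) • ρ) = c * vonNeumannEntropy ρ + Real.negMulLog c * ρ.trace.re := by
  have hcρ : ((c : ℂ) • ρ).IsHermitian := by
    unfold Matrix.IsHermitian at hρ ⊢
    rw [Matrix.conjTranspose_smul, hρ, Complex.star_def, Complex.conj_ofReal]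
  have hsa : IsSelfAdjoint ρ := hρ
  have hreal : (c : ℂ) • ρ = c • ρ := by
    ext i j; simp [Matrix.smul_apply, Complex.real_smul]
  rw [vonNeumannEntropy_eq_re_trace_cfc_negMulLog hcρ, vonNeumannEntropy_eq_re_trace_cfc_negMulLog hρ,
    hreal]
  have hcomp : cfc (fun x : ℝ => Real.negMulLog (c • x)) ρ = cfc Real.negMulLog (c • ρ) :=
    cfc_comp_smul c Real.negMulLog ρ (Real.continuous_negMulLog.continuousOn) hsa
  have hsplit : cfc (fun x : ℝ => Real.negMulLog (c • x)) ρ =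
      cfc (fun x : ℝ => c * Real.negMulLog x + Real.negMulLog c * x) ρ := by
    refine cfc_congr fun x _ => ?_
    simp only [smul_eq_mul]
    rw [Real.negMulLog_mul]
    ring
  have hadd : cfc (fun x : ℝ => c * Real.negMulLog x + Real.negMulLog c * x) ρ =
      c • cfc Real.negMulLog ρ + Real.negMulLog c • ρ := by
    rw [cfc_add (a := ρ) (fun x : ℝ => c * Real.negMulLog x) (fun x : ℝ => Real.negMulLog c * x)
        ((continuous_const.mul Real.continuous_negMulLog).continuousOn)
        ((continuous_const.mul continuous_id).continuousOn),
      cfc_const_mul c Real.negMulLog ρ (Real.continuous_negMulLog.continuousOn),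
      cfc_const_mul (Real.negMulLog c) (fun x : ℝ => x) ρ (continuous_id.continuousOn),
      cfc_id' ℝ ρ hsa]
  rw [← hcomp, hsplit, hadd, Matrix.trace_add, Matrix.trace_smul, Matrix.trace_smul, Complex.add_re,
    Complex.smul_re, Complex.smul_re, smul_eq_mul, smul_eq_mul]

variable {A B X : Type} [Fintype A] [DecidableEq A] [Fintype B] [DecidableEq B] [Fintype X]
  [DecidableEq X]

/-- `S(p ρ) − S(Tr_A (p ρ)) = p (S(ρ) − S(Tr_A ρ))` for a Hermitian `ρ` and real `p` (the `η(p) Tr`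
terms cancel because the partial trace is trace preserving): positive homogeneity of the conditional
entropy. [cite: LiebRuskai1973, Theorem 1] -/
theorem vonNeumannEntropy_smul_sub_traceLeft {ρ : Matrix (A × B) (A × B) ℂ} (hρ : ρ.IsHermitian)
    (p : ℝ) :
    vonNeumannEntropy ((p : ℂ) • ρ) - vonNeumannEntropy (traceLeft ((p : ℂ) • ρ)) =
      p * (vonNeumannEntropy ρ - vonNeumannEntropy (traceLeft ρ)) := by
  rw [traceLeft_smul, vonNeumannEntropy_smul hρ p, vonNeumannEntropy_smul (isHermitian_traceLeft hρ) p,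
    trace_traceLeft]
  ring

omit [Fintype A] [DecidableEq A] [DecidableEq B] in
/-- `Tr_B` of a Hermitian matrix is Hermitian. [cite: BurgisserChristandlIkenmeyer2011, §2.2] -/
theorem isHermitian_traceRight {ρ : Matrix (A × B) (A × B) ℂ} (hρ : ρ.IsHermitian) :
    (traceRight ρ).IsHermitian := by
  rw [← traceLeft_submatrix_swap]
  exact isHermitian_traceLeft (hρ.submatrix _)

/-- `S(p ρ) − S(Tr_B (p ρ)) = p (S(ρ) − S(Tr_B ρ))` for real `p`. [cite: LiebRuskai1973, Theorem 1] -/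
theorem vonNeumannEntropy_smul_sub_traceRight {ρ : Matrix (A × B) (A × B) ℂ} (hρ : ρ.IsHermitian)
    (p : ℝ) :
    vonNeumannEntropy ((p : ℂ) • ρ) - vonNeumannEntropy (traceRight ((p : ℂ) • ρ)) =
      p * (vonNeumannEntropy ρ - vonNeumannEntropy (traceRight ρ)) := by
  rw [traceRight_smul, vonNeumannEntropy_smul hρ p,
    vonNeumannEntropy_smul (isHermitian_traceRight hρ) p, trace_traceRight]
  ring

/-- **Concavity of the conditional entropy `S(A|B)`, textbook form**: for density matrices `ρ_x` on
`ℋ_A ⊗ ℋ_B` and a probability vector `p`, `Σ_x p_x (S(ρ_x) − S(Tr_A ρ_x)) ≤ S(ρ̄) − S(Tr_A ρ̄)` with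
`ρ̄ = Σ_x p_x ρ_x`. [cite: LiebRuskai1973, Theorem 1] [cite: NielsenChuang2010, Corollary 11.13 p.521] -/
theorem convexComb_vonNeumannEntropy_sub_traceLeft_le (p : X → ℝ) (hp : ∀ x, 0 ≤ p x)
    (hp1 : ∑ x, p x = 1) (ρ : X → Matrix (A × B) (A × B) ℂ) (hρ : ∀ x, IsDensity (ρ x)) :
    ∑ x, p x * (vonNeumannEntropy (ρ x) - vonNeumannEntropy (traceLeft (ρ x))) ≤
      vonNeumannEntropy (∑ x, (p x : ℂ) • ρ x) -
        vonNeumannEntropy (traceLeft (∑ x, (p x : ℂ) • ρ x)) := by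
  have hτ : ∀ x, ((p x : ℂ) • ρ x).PosSemidef := fun x =>
    (hρ x).1.smul (Complex.zero_le_real.mpr (hp x))
  have htr : ∑ x, ((p x : ℂ) • ρ x).trace = 1 := by
    simp only [Matrix.trace_smul, smul_eq_mul]
    rw [show ∑ x, (p x : ℂ) * (ρ x).trace = ∑ x, (p x : ℂ) from
      Finset.sum_congr rfl fun x _ => by rw [(hρ x).2, mul_one]]
    exact_mod_cast hp1
  have key := sum_vonNeumannEntropy_sub_traceLeft_le _ hτ htr
  calc ∑ x, p x * (vonNeumannEntropy (ρ x) - vonNeumannEntropy (traceLeft (ρ x)))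
      = ∑ x, (vonNeumannEntropy ((p x : ℂ) • ρ x) -
          vonNeumannEntropy (traceLeft ((p x : ℂ) • ρ x))) :=
        Finset.sum_congr rfl fun x _ => (vonNeumannEntropy_smul_sub_traceLeft (hρ x).1.1 (p x)).symm
    _ ≤ _ := key

/-- **Concavity of `S(B|A)`, textbook form**: `Σ_x p_x (S(ρ_x) − S(Tr_B ρ_x)) ≤ S(ρ̄) − S(Tr_B ρ̄)`.
[cite: LiebRuskai1973, Theorem 1] [cite: NielsenChuang2010, Corollary 11.13 p.521] -/
theorem convexComb_vonNeumannEntropy_sub_traceRight_le (p : X → ℝ) (hp : ∀ x, 0 ≤ p x)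
    (hp1 : ∑ x, p x = 1) (ρ : X → Matrix (A × B) (A × B) ℂ) (hρ : ∀ x, IsDensity (ρ x)) :
    ∑ x, p x * (vonNeumannEntropy (ρ x) - vonNeumannEntropy (traceRight (ρ x))) ≤
      vonNeumannEntropy (∑ x, (p x : ℂ) • ρ x) -
        vonNeumannEntropy (traceRight (∑ x, (p x : ℂ) • ρ x)) := by
  have hτ : ∀ x, ((p x : ℂ) • ρ x).PosSemidef := fun x =>
    (hρ x).1.smul (Complex.zero_le_real.mpr (hp x))
  have htr : ∑ x, ((p x : ℂ) • ρ x).trace = 1 := by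
    simp only [Matrix.trace_smul, smul_eq_mul]
    rw [show ∑ x, (p x : ℂ) * (ρ x).trace = ∑ x, (p x : ℂ) from
      Finset.sum_congr rfl fun x _ => by rw [(hρ x).2, mul_one]]
    exact_mod_cast hp1
  have key := sum_vonNeumannEntropy_sub_traceRight_le _ hτ htr
  calc ∑ x, p x * (vonNeumannEntropy (ρ x) - vonNeumannEntropy (traceRight (ρ x)))
      = ∑ x, (vonNeumannEntropy ((p x : ℂ) • ρ x) -
          vonNeumannEntropy (traceRight ((p x : ℂ) • ρ x))) :=
        Finset.sum_congr rfl fun x _ => (vonNeumannEntropy_smul_sub_traceRight (hρ x).1.1 (p x)).symm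
    _ ≤ _ := key

/-- **Nonnegative conditional entropy survives averaging** (trace out the first factor): if each
density matrix `ρ_x` (`x ∈ X`, finite, nonempty) satisfies `0 ≤ S(ρ_x) − S(Tr_A ρ_x)`, then so does
the uniform average `ρ̄ = |X|⁻¹ Σ_x ρ_x`. This is the form in which the entropy constraints of a
symmetrised translation-invariant SDP relaxation are justified: the window state is replaced by its
average over a finite symmetry group. [cite: LiebRuskai1973, Theorem 1]
[cite: FawziFawziScalet2024Entropy, Theorem 4.1] -/
theorem vonNeumannEntropy_sub_traceLeft_avg_nonneg [Nonempty X] (ρ : X → Matrix (A × B) (A × B) ℂ)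
    (hρ : ∀ x, IsDensity (ρ x))
    (hpos : ∀ x, 0 ≤ vonNeumannEntropy (ρ x) - vonNeumannEntropy (traceLeft (ρ x))) :
    0 ≤ vonNeumannEntropy ((Fintype.card X : ℂ)⁻¹ • ∑ x, ρ x) -
      vonNeumannEntropy (traceLeft ((Fintype.card X : ℂ)⁻¹ • ∑ x, ρ x)) := by
  have hN : (0 : ℝ) < Fintype.card X := Nat.cast_pos.mpr Fintype.card_pos
  set p : X → ℝ := fun _ => (Fintype.card X : ℝ)⁻¹ with hp
  have hp0 : ∀ x, 0 ≤ p x := fun _ => inv_nonneg.mpr hN.le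
  have hp1 : ∑ x, p x = 1 := by
    rw [hp, Finset.sum_const, Finset.card_univ, nsmul_eq_mul, mul_inv_cancel₀ hN.ne']
  have key := convexComb_vonNeumannEntropy_sub_traceLeft_le p hp0 hp1 ρ hρ
  have hsum : ∑ x, (p x : ℂ) • ρ x = (Fintype.card X : ℂ)⁻¹ • ∑ x, ρ x := by
    rw [Finset.smul_sum]
    refine Finset.sum_congr rfl fun x _ => ?_
    rw [hp]
    push_cast
    rfl
  rw [hsum] at key
  refine le_trans (Finset.sum_nonneg fun x _ => mul_nonneg (hp0 x) (hpos x)) key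

/-- **Nonnegative conditional entropy survives averaging** (trace out the second factor): if each
density matrix `ρ_x` satisfies `0 ≤ S(ρ_x) − S(Tr_B ρ_x)`, then so does `ρ̄ = |X|⁻¹ Σ_x ρ_x`.
[cite: LiebRuskai1973, Theorem 1] [cite: FawziFawziScalet2024Entropy, Theorem 4.1] -/
theorem vonNeumannEntropy_sub_traceRight_avg_nonneg [Nonempty X] (ρ : X → Matrix (A × B) (A × B) ℂ)
    (hρ : ∀ x, IsDensity (ρ x))
    (hpos : ∀ x, 0 ≤ vonNeumannEntropy (ρ x) - vonNeumannEntropy (traceRight (ρ x))) :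
    0 ≤ vonNeumannEntropy ((Fintype.card X : ℂ)⁻¹ • ∑ x, ρ x) -
      vonNeumannEntropy (traceRight ((Fintype.card X : ℂ)⁻¹ • ∑ x, ρ x)) := by
  have hN : (0 : ℝ) < Fintype.card X := Nat.cast_pos.mpr Fintype.card_pos
  set p : X → ℝ := fun _ => (Fintype.card X : ℝ)⁻¹ with hp
  have hp0 : ∀ x, 0 ≤ p x := fun _ => inv_nonneg.mpr hN.le
  have hp1 : ∑ x, p x = 1 := by
    rw [hp, Finset.sum_const, Finset.card_univ, nsmul_eq_mul, mul_inv_cancel₀ hN.ne']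
  have key := convexComb_vonNeumannEntropy_sub_traceRight_le p hp0 hp1 ρ hρ
  have hsum : ∑ x, (p x : ℂ) • ρ x = (Fintype.card X : ℂ)⁻¹ • ∑ x, ρ x := by
    rw [Finset.smul_sum]
    refine Finset.sum_congr rfl fun x _ => ?_
    rw [hp]
    push_cast
    rfl
  rw [hsum] at key
  refine le_trans (Finset.sum_nonneg fun x _ => mul_nonneg (hp0 x) (hpos x)) key

end Weighted

/-! ### Unitary invariance -/

section Unitary

variable {m : Type*} [Fintype m] [DecidableEq m]

/-- **Unitary invariance of the entropy**: `S(U ρ U⋆) = S(ρ)` for `U` unitary and `ρ` Hermitian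
(`U ρ U⋆ = U ρ U⁻¹` has the characteristic polynomial of `ρ`).
[cite: NielsenChuang2010, Theorem 11.8 (3) (proof) p.513] -/
theorem vonNeumannEntropy_unitary_conj {U : Matrix m m ℂ} (hU : U ∈ Matrix.unitaryGroup m ℂ)
    {ρ : Matrix m m ℂ} (hρ : ρ.IsHermitian) :
    vonNeumannEntropy (U * ρ * Uᴴ) = vonNeumannEntropy ρ := by
  have hUU : Uᴴ * U = 1 := by
    simpa [Matrix.star_eq_conjTranspose] using Matrix.mem_unitaryGroup_iff'.mp hU
  have hH : (U * ρ * Uᴴ).IsHermitian := by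
    have := Matrix.isHermitian_conjTranspose_mul_mul Uᴴ hρ
    simpa [Matrix.conjTranspose_conjTranspose] using this
  refine vonNeumannEntropy_eq_of_charpoly_eq hH hρ ?_
  rw [Matrix.mul_assoc, Matrix.charpoly_mul_comm, Matrix.mul_assoc, hUU, Matrix.mul_one]

end Unitary

end Literature.InformationTheory.Entropy
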